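import Mathlib
import Summits.Ventures.PercRepro2.Defs
import Summits.Ventures.PercRepro2.Graph
import Summits.Ventures.PercRepro2.Induced
import Summits.Ventures.PercRepro2.VdBKahn
import Summits.Ventures.PercRepro2.ReimerVdBK
import Summits.Ventures.PercRepro2.ReimerVdBKRegions
import Summits.Ventures.PercRepro2.ReimerVdBKZClosed
import Summits.Ventures.PercRepro2.ReimerVdBKZReduction
import Summits.Ventures.PercRepro2.ReimerVdBKZSplit
import Summits.Ventures.PercRepro2.ReimerVdBKZRecursion
import Summits.Ventures.PercRepro2.ReimerVdBKTypeWeight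
import Summits.Ventures.PercRepro2.ReimerVdBKPairType
import Summits.Ventures.PercRepro2.ReimerVdBKCoreDown
import Summits.Ventures.PercRepro2.ReimerVdBKCoreD
import Summits.Ventures.PercRepro2.ReimerVdBKDegTwoGraph
import Summits.Ventures.PercRepro2.ReimerVdBKDegTwoFlip

/-!
# The degree-2 expansion, III: (CORE↓) at a vertex of degree 2 follows from Harris and GENSYM
(blind cell PercRepro2, mine-c g47; `conjectures/MINE-C.md` §55.6 (the paper lemma), §56.7)

Sorting the colourings of `G` by the colour pattern of the star at the unmarked degree-2 vertex `v`:
same colour — a colouring of `G⁺`, `v` never in the core (`term_same`); `e₁` open, `e₂` closed — a colouring of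
`G°` with `v ∈ K₁ ∩ K₂` iff `[u₁ ∈ K₁][u₂ ∈ K₂]` (`term_TF`); the mirror pattern (`term_FT`).  Summing,
`4 · coreCount A X B Y {v} = 2 · reimerCount⁺ A X B Y + gensymCount° A X B Y u₁ u₂` (`four_mul_coreCount`),
and THEOREM `coreDown_of_genSym`: for a Harris pair, (CORE↓) at `v` follows from Harris on `G⁺`
(`rvdBK_of_disjoint`) and GENSYM`(u₁, u₂)` on `G°`.
-/

namespace Summit.Ventures.PercRepro2
namespace ReimerVdBK
open Classical

variable {V : Type*} {E : Type*} [Fintype E] [DecidableEq E] [Fintype V] [DecidableEq V]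
variable (ends : E → Sym2 V) (s : V)

/-! ## The expansion -/

section Expansion
variable {v u₁ u₂ : V} {e₁ e₂ : E} (A X B Y : Finset V)

omit [Fintype E] [DecidableEq E] [Fintype V] in
/-- The two-world event transfers along connection equivalences at the marked vertices. -/
lemma mem_twoWorld_iff_of_conn_iff {ends' : E → Sym2 V} {ω : Config E}
    (h1 : ∀ w ∈ A ∪ X ∪ B ∪ Y, (Conn ends ω s w ↔ Conn ends' ω s w))
    (h2 : ∀ w ∈ A ∪ X ∪ B ∪ Y, (Conn ends (compl ω) s w ↔ Conn ends' (compl ω) s w)) :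
    ω ∈ twoWorld ends s A X B Y ↔ ω ∈ twoWorld ends' s A X B Y := by
  rw [mem_twoWorld_iff, mem_twoWorld_iff]
  simp only [mem_K₁, mem_K₂]
  have mA : ∀ a ∈ A, a ∈ A ∪ X ∪ B ∪ Y := fun a ha =>
    Finset.mem_union_left _ (Finset.mem_union_left _ (Finset.mem_union_left _ ha))
  have mX : ∀ x ∈ X, x ∈ A ∪ X ∪ B ∪ Y := fun x hx =>
    Finset.mem_union_left _ (Finset.mem_union_left _ (Finset.mem_union_right _ hx))
  have mB : ∀ b ∈ B, b ∈ A ∪ X ∪ B ∪ Y := fun b hb =>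
    Finset.mem_union_left _ (Finset.mem_union_right _ hb)
  have mY : ∀ y ∈ Y, y ∈ A ∪ X ∪ B ∪ Y := fun y hy => Finset.mem_union_right _ hy
  constructor
  · rintro ⟨hA, hX, hB, hY⟩
    exact ⟨fun a ha => (h1 a (mA a ha)).1 (hA a ha), fun x hx hc => hX x hx ((h1 x (mX x hx)).2 hc),
      fun b hb => (h2 b (mB b hb)).1 (hB b hb), fun y hy hc => hY y hy ((h2 y (mY y hy)).2 hc)⟩
  · rintro ⟨hA, hX, hB, hY⟩
    exact ⟨fun a ha => (h1 a (mA a ha)).2 (hA a ha), fun x hx hc => hX x hx ((h1 x (mX x hx)).1 hc),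
      fun b hb => (h2 b (mB b hb)).2 (hB b hb), fun y hy hc => hY y hy ((h2 y (mY y hy)).1 hc)⟩


/-- **Same colour on the star**: the core-restricted term is the `G⁺` term. -/
lemma term_same (hd : Deg2 ends v u₁ u₂ e₁ e₂) (hsv : s ≠ v) (hv : v ∉ A ∪ X ∪ B ∪ Y)
    {ω : Config E} (hsame : ω e₁ = ω e₂) :
    (if ω ∈ twoWorld ends s A X B Y ∧ ¬ (Conn ends ω s v ∧ Conn ends (compl ω) s v) then 1 else 0) =
      (if ω ∈ twoWorld (endsPlus ends v u₁ u₂ e₁ e₂) s A X B Y then (1 : ℕ) else 0) := by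
  have hsame' : compl ω e₁ = compl ω e₂ := by simp [compl_apply, hsame]
  have hw : ∀ w ∈ A ∪ X ∪ B ∪ Y, w ≠ v := fun w hw hwv => hv (hwv ▸ hw)
  have htw : ω ∈ twoWorld ends s A X B Y ↔ ω ∈ twoWorld (endsPlus ends v u₁ u₂ e₁ e₂) s A X B Y :=
    mem_twoWorld_iff_of_conn_iff ends s A X B Y
      (fun w hw' => conn_iff_endsPlus ends s hd hsv hsame (hw w hw'))
      (fun w hw' => conn_iff_endsPlus ends s hd hsv hsame' (hw w hw'))
  have hcore : ¬ (Conn ends ω s v ∧ Conn ends (compl ω) s v) := by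
    rintro ⟨hv1, hv2⟩
    cases h : ω e₁ with
    | false =>
      exact not_conn_of_star_closed ends s hd hsv h (hsame ▸ h) hv1
    | true =>
      have c1 : compl ω e₁ = false := by simp [compl_apply, h]
      have c2 : compl ω e₂ = false := by simp [compl_apply, ← hsame, h]
      exact not_conn_of_star_closed ends s hd hsv c1 c2 hv2
  by_cases h : ω ∈ twoWorld ends s A X B Y
  · rw [if_pos ⟨h, hcore⟩, if_pos (htw.1 h)]
  · rw [if_neg (fun h' => h h'.1), if_neg (fun h' => h (htw.2 h'))]


/-- **`e₁` open, `e₂` closed**: the core-restricted term is the `G°` term with the pin `[u₁ ∈ K₁][u₂ ∈ K₂]`. -/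
lemma term_TF (hd : Deg2 ends v u₁ u₂ e₁ e₂) (hsv : s ≠ v) (hv : v ∉ A ∪ X ∪ B ∪ Y)
    {ω : Config E} (h1 : ω e₁ = true) (h2 : ω e₂ = false) :
    (if ω ∈ twoWorld ends s A X B Y ∧ ¬ (Conn ends ω s v ∧ Conn ends (compl ω) s v) then 1 else 0) =
      (if ω ∈ twoWorld (endsLoop ends v e₁ e₂) s A X B Y then
        (if Conn (endsLoop ends v e₁ e₂) ω s u₁ ∧ Conn (endsLoop ends v e₁ e₂) (compl ω) s u₂
          then 0 else 1) else (0 : ℕ)) := by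
  have hw : ∀ w ∈ A ∪ X ∪ B ∪ Y, w ≠ v := fun w hw hwv => hv (hwv ▸ hw)
  obtain ⟨hc1, hv1⟩ := conn_iff_endsLoop ends s hd hsv h1 h2
  have h1' : compl ω e₂ = true := by simp [compl_apply, h2]
  have h2' : compl ω e₁ = false := by simp [compl_apply, h1]
  obtain ⟨hc2, hv2⟩ := conn_iff_endsLoop ends s hd.swap hsv h1' h2'
  rw [endsLoop_swap ends hd.ne] at hc2 hv2
  have htw : ω ∈ twoWorld ends s A X B Y ↔ ω ∈ twoWorld (endsLoop ends v e₁ e₂) s A X B Y :=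
    mem_twoWorld_iff_of_conn_iff ends s A X B Y (fun w hw' => hc1 w (hw w hw'))
      (fun w hw' => hc2 w (hw w hw'))
  by_cases h : ω ∈ twoWorld ends s A X B Y
  · rw [if_pos (htw.1 h)]
    by_cases hp : Conn (endsLoop ends v e₁ e₂) ω s u₁ ∧ Conn (endsLoop ends v e₁ e₂) (compl ω) s u₂
    · rw [if_pos hp, if_neg]
      rintro ⟨_, hc⟩
      exact hc ⟨hv1.2 hp.1, hv2.2 hp.2⟩
    · rw [if_neg hp, if_pos]
      refine ⟨h, fun hc => hp ⟨hv1.1 hc.1, hv2.1 hc.2⟩⟩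
  · rw [if_neg (fun h' => h h'.1), if_neg (fun h' => h (htw.2 h'))]


/-- **`e₁` closed, `e₂` open**: the core-restricted term is the `G°` term with the pin `[u₂ ∈ K₁][u₁ ∈ K₂]`. -/
lemma term_FT (hd : Deg2 ends v u₁ u₂ e₁ e₂) (hsv : s ≠ v) (hv : v ∉ A ∪ X ∪ B ∪ Y)
    {ω : Config E} (h1 : ω e₁ = false) (h2 : ω e₂ = true) :
    (if ω ∈ twoWorld ends s A X B Y ∧ ¬ (Conn ends ω s v ∧ Conn ends (compl ω) s v) then 1 else 0) =
      (if ω ∈ twoWorld (endsLoop ends v e₁ e₂) s A X B Y then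
        (if Conn (endsLoop ends v e₁ e₂) ω s u₂ ∧ Conn (endsLoop ends v e₁ e₂) (compl ω) s u₁
          then 0 else 1) else (0 : ℕ)) := by
  have hw : ∀ w ∈ A ∪ X ∪ B ∪ Y, w ≠ v := fun w hw hwv => hv (hwv ▸ hw)
  obtain ⟨hc1, hv1⟩ := conn_iff_endsLoop ends s hd.swap hsv h2 h1
  rw [endsLoop_swap ends hd.ne] at hc1 hv1
  have h1' : compl ω e₁ = true := by simp [compl_apply, h1]
  have h2' : compl ω e₂ = false := by simp [compl_apply, h2]
  obtain ⟨hc2, hv2⟩ := conn_iff_endsLoop ends s hd hsv h1' h2'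
  have htw : ω ∈ twoWorld ends s A X B Y ↔ ω ∈ twoWorld (endsLoop ends v e₁ e₂) s A X B Y :=
    mem_twoWorld_iff_of_conn_iff ends s A X B Y (fun w hw' => hc1 w (hw w hw'))
      (fun w hw' => hc2 w (hw w hw'))
  by_cases h : ω ∈ twoWorld ends s A X B Y
  · rw [if_pos (htw.1 h)]
    by_cases hp : Conn (endsLoop ends v e₁ e₂) ω s u₂ ∧ Conn (endsLoop ends v e₁ e₂) (compl ω) s u₁
    · rw [if_pos hp, if_neg]
      rintro ⟨_, hc⟩
      exact hc ⟨hv1.2 hp.1, hv2.2 hp.2⟩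
    · rw [if_neg hp, if_pos]
      refine ⟨h, fun hc => hp ⟨hv1.1 hc.1, hv2.1 hc.2⟩⟩
  · rw [if_neg (fun h' => h h'.1), if_neg (fun h' => h (htw.2 h'))]

/-- The core-restricted count at the single vertex `v`, as a sum. -/
lemma coreCount_singleton_eq_sum :
    coreCount ends s A X B Y {v} = ∑ ω : Config E,
      (if ω ∈ twoWorld ends s A X B Y ∧ ¬ (Conn ends ω s v ∧ Conn ends (compl ω) s v) then 1 else 0) := by
  unfold coreCount
  rw [pcount_coreW_eq_count]
  unfold count
  refine Finset.sum_congr rfl fun ω _ => ?_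
  simp only [Set.mem_inter_iff, Set.mem_setOf_eq, Finset.mem_singleton, forall_eq]

omit [Fintype V] in
/-- A sum over the configurations with `e ≠ e'` of a given colour pattern is a quarter of the sum of a function blind
to both colours. -/
lemma four_mul_sum_pattern (e e' : E) (hne : e ≠ e') (f : Config E → ℕ)
    (hf : ∀ ω, f (flipE e ω) = f ω) (hf' : ∀ ω, f (flipE e' ω) = f ω) (b b' : Bool) :
    4 * ∑ ω : Config E, (if ω e = b ∧ ω e' = b' then f ω else 0) = ∑ ω : Config E, f ω := by
  have h1 : ∑ ω : Config E, (if ω e = b ∧ ω e' = b' then f ω else 0) =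
      ∑ ω : Config E, (if ω e' = b' then (if ω e = b then f ω else 0) else 0) := by
    refine Finset.sum_congr rfl fun ω _ => ?_
    by_cases h : ω e = b <;> by_cases h' : ω e' = b' <;> simp [h, h']
  have hg : ∀ ω, (if flipE e' ω e = b then f (flipE e' ω) else 0) = (if ω e = b then f ω else 0) := by
    intro ω
    rw [flipE_apply_of_ne hne, hf']
  have h2 := two_mul_sum_filter_eq e' (fun ω => if ω e = b then f ω else 0) hg b'
  have h3 := two_mul_sum_filter_eq e f hf b
  rw [h1, show (4 : ℕ) = 2 * 2 by norm_num, mul_assoc, h2, h3]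

omit [Fintype V] in
/-- A sum over the configurations with `e, e'` of the same colour is half of the sum of a function blind to the
colour of `e'`. -/
lemma two_mul_sum_same (e e' : E) (hne : e ≠ e') (f : Config E → ℕ) (hf' : ∀ ω, f (flipE e' ω) = f ω) :
    2 * ∑ ω : Config E, (if ω e = ω e' then f ω else 0) = ∑ ω : Config E, f ω := by
  have h1 : ∑ ω : Config E, (if ω e = ω e' then f ω else 0) =
      ∑ ω : Config E, (if ω e ≠ ω e' then f ω else 0) := by
    conv_rhs => rw [← sum_flipE e']
    refine Finset.sum_congr rfl fun ω _ => ?_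
    rw [flipE_apply_self, flipE_apply_of_ne hne, hf']
    cases h : ω e <;> cases h' : ω e' <;> simp
  have h2 : ∑ ω : Config E, f ω =
      ∑ ω : Config E, ((if ω e = ω e' then f ω else 0) + (if ω e ≠ ω e' then f ω else 0)) := by
    refine Finset.sum_congr rfl fun ω _ => ?_
    by_cases h : ω e = ω e' <;> simp [h]
  rw [h2, Finset.sum_add_distrib, ← h1, two_mul]

omit [Fintype E] [Fintype V] [DecidableEq V] in
/-- The `G⁺` term is blind to the colour of `e₂` (a loop of `G⁺`). -/
lemma gplus_flip (ω : Config E) :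
    (if flipE e₂ ω ∈ twoWorld (endsPlus ends v u₁ u₂ e₁ e₂) s A X B Y then (1 : ℕ) else 0) =
      (if ω ∈ twoWorld (endsPlus ends v u₁ u₂ e₁ e₂) s A X B Y then 1 else 0) := by
  have hloop : (endsPlus ends v u₁ u₂ e₁ e₂ e₂).IsDiag := by
    rw [endsPlus_e₂]; exact Sym2.mk_isDiag_iff.2 rfl
  unfold flipE
  rw [mem_twoWorld_update_of_loop s hloop]

/-- A `G°` term is blind to the colour of `e` whenever `e` is a loop of `G°`. -/
lemma gloop_flip (hne : e₁ ≠ e₂) {e : E} (he : e = e₁ ∨ e = e₂) (a b : V) (ω : Config E) :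
    (if flipE e ω ∈ twoWorld (endsLoop ends v e₁ e₂) s A X B Y then
        (if Conn (endsLoop ends v e₁ e₂) (flipE e ω) s a ∧
          Conn (endsLoop ends v e₁ e₂) (compl (flipE e ω)) s b then 0 else 1) else (0 : ℕ)) =
      (if ω ∈ twoWorld (endsLoop ends v e₁ e₂) s A X B Y then
        (if Conn (endsLoop ends v e₁ e₂) ω s a ∧ Conn (endsLoop ends v e₁ e₂) (compl ω) s b
          then 0 else 1) else 0) := by
  have hloop : (endsLoop ends v e₁ e₂ e).IsDiag := by
    rcases he with rfl | rfl
    · rw [endsLoop_e₁ ends hne]; exact Sym2.mk_isDiag_iff.2 rfl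
    · rw [endsLoop_e₂]; exact Sym2.mk_isDiag_iff.2 rfl
  unfold flipE
  simp only [mem_twoWorld_update_of_loop s hloop, compl_update_flip, conn_update_of_loop hloop]

omit [Fintype E] [DecidableEq E] [Fintype V] [DecidableEq V] in
/-- The selector of the colour pattern of the star. -/
def sel (b₁ b₂ : Bool) (g h₁ h₂ : ℕ) : ℕ := if b₁ = b₂ then g else if b₁ then h₁ else h₂

omit [Fintype V] [DecidableEq V] in
/-- Summing the selector is summing the three colour classes. -/
lemma sum_sel (e e' : E) (g h₁ h₂ : Config E → ℕ) :
    ∑ ω : Config E, sel (ω e) (ω e') (g ω) (h₁ ω) (h₂ ω) =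
      ∑ ω : Config E, (if ω e = ω e' then g ω else 0) +
        (∑ ω : Config E, (if ω e = true ∧ ω e' = false then h₁ ω else 0) +
          ∑ ω : Config E, (if ω e = false ∧ ω e' = true then h₂ ω else 0)) := by
  rw [← Finset.sum_add_distrib, ← Finset.sum_add_distrib]
  refine Finset.sum_congr rfl fun ω _ => ?_
  cases ω e <;> cases ω e' <;> simp [sel]

/-- The pointwise split of the core-restricted term by the colour pattern of the star. -/
lemma term_split (hd : Deg2 ends v u₁ u₂ e₁ e₂) (hsv : s ≠ v) (hv : v ∉ A ∪ X ∪ B ∪ Y) (ω : Config E) :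
    (if ω ∈ twoWorld ends s A X B Y ∧ ¬ (Conn ends ω s v ∧ Conn ends (compl ω) s v) then (1 : ℕ) else 0) = sel (ω e₁) (ω e₂) (if ω ∈ twoWorld (endsPlus ends v u₁ u₂ e₁ e₂) s A X B Y then (1 : ℕ) else 0) (if ω ∈ twoWorld (endsLoop ends v e₁ e₂) s A X B Y then (if Conn (endsLoop ends v e₁ e₂) ω s u₁ ∧ Conn (endsLoop ends v e₁ e₂) (compl ω) s u₂ then 0 else 1) else (0 : ℕ)) (if ω ∈ twoWorld (endsLoop ends v e₁ e₂) s A X B Y then (if Conn (endsLoop ends v e₁ e₂) ω s u₂ ∧ Conn (endsLoop ends v e₁ e₂) (compl ω) s u₁ then 0 else 1) else (0 : ℕ)) := by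
  cases h1 : ω e₁ <;> cases h2 : ω e₂
  · show (if ω ∈ twoWorld ends s A X B Y ∧ ¬ (Conn ends ω s v ∧ Conn ends (compl ω) s v) then (1 : ℕ) else 0) = (if ω ∈ twoWorld (endsPlus ends v u₁ u₂ e₁ e₂) s A X B Y then (1 : ℕ) else 0)
    exact term_same ends s A X B Y hd hsv hv (h1.trans h2.symm)
  · show (if ω ∈ twoWorld ends s A X B Y ∧ ¬ (Conn ends ω s v ∧ Conn ends (compl ω) s v) then (1 : ℕ) else 0) = (if ω ∈ twoWorld (endsLoop ends v e₁ e₂) s A X B Y then (if Conn (endsLoop ends v e₁ e₂) ω s u₂ ∧ Conn (endsLoop ends v e₁ e₂) (compl ω) s u₁ then 0 else 1) else (0 : ℕ))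
    exact term_FT ends s A X B Y hd hsv hv h1 h2
  · show (if ω ∈ twoWorld ends s A X B Y ∧ ¬ (Conn ends ω s v ∧ Conn ends (compl ω) s v) then (1 : ℕ) else 0) = (if ω ∈ twoWorld (endsLoop ends v e₁ e₂) s A X B Y then (if Conn (endsLoop ends v e₁ e₂) ω s u₁ ∧ Conn (endsLoop ends v e₁ e₂) (compl ω) s u₂ then 0 else 1) else (0 : ℕ))
    exact term_TF ends s A X B Y hd hsv hv h1 h2
  · show (if ω ∈ twoWorld ends s A X B Y ∧ ¬ (Conn ends ω s v ∧ Conn ends (compl ω) s v) then (1 : ℕ) else 0) = (if ω ∈ twoWorld (endsPlus ends v u₁ u₂ e₁ e₂) s A X B Y then (1 : ℕ) else 0)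
    exact term_same ends s A X B Y hd hsv hv (h1.trans h2.symm)

/-- **The degree-2 expansion**: `4 · coreCount A X B Y {v} = 2 · reimerCount⁺ A X B Y + gensymCount° A X B Y u₁ u₂`. -/
theorem four_mul_coreCount (hd : Deg2 ends v u₁ u₂ e₁ e₂) (hsv : s ≠ v) (hv : v ∉ A ∪ X ∪ B ∪ Y) :
    4 * coreCount ends s A X B Y {v} =
      2 * reimerCount (endsPlus ends v u₁ u₂ e₁ e₂) s A X B Y +
        gensymCount (endsLoop ends v e₁ e₂) s A X B Y u₁ u₂ := by
  have hsplit : ∑ ω : Config E, (if ω ∈ twoWorld ends s A X B Y ∧ ¬ (Conn ends ω s v ∧ Conn ends (compl ω) s v) then (1 : ℕ) else 0) =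
      ∑ ω : Config E, (if ω e₁ = ω e₂ then (if ω ∈ twoWorld (endsPlus ends v u₁ u₂ e₁ e₂) s A X B Y then (1 : ℕ) else 0) else 0) +
        (∑ ω : Config E, (if ω e₁ = true ∧ ω e₂ = false then (if ω ∈ twoWorld (endsLoop ends v e₁ e₂) s A X B Y then (if Conn (endsLoop ends v e₁ e₂) ω s u₁ ∧ Conn (endsLoop ends v e₁ e₂) (compl ω) s u₂ then 0 else 1) else (0 : ℕ)) else 0) +
          ∑ ω : Config E, (if ω e₁ = false ∧ ω e₂ = true then (if ω ∈ twoWorld (endsLoop ends v e₁ e₂) s A X B Y then (if Conn (endsLoop ends v e₁ e₂) ω s u₂ ∧ Conn (endsLoop ends v e₁ e₂) (compl ω) s u₁ then 0 else 1) else (0 : ℕ)) else 0)) := by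
    rw [← sum_sel]
    exact Finset.sum_congr rfl fun ω _ => term_split ends s A X B Y hd hsv hv ω
  have hG := two_mul_sum_same e₁ e₂ hd.ne (fun ω => (if ω ∈ twoWorld (endsPlus ends v u₁ u₂ e₁ e₂) s A X B Y then (1 : ℕ) else 0)) (fun ω => gplus_flip ends s A X B Y ω)
  have hH₁ := four_mul_sum_pattern e₁ e₂ hd.ne (fun ω => (if ω ∈ twoWorld (endsLoop ends v e₁ e₂) s A X B Y then (if Conn (endsLoop ends v e₁ e₂) ω s u₁ ∧ Conn (endsLoop ends v e₁ e₂) (compl ω) s u₂ then 0 else 1) else (0 : ℕ)))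
    (fun ω => gloop_flip ends s A X B Y hd.ne (Or.inl rfl) u₁ u₂ ω)
    (fun ω => gloop_flip ends s A X B Y hd.ne (Or.inr rfl) u₁ u₂ ω) true false
  have hH₂ := four_mul_sum_pattern e₁ e₂ hd.ne (fun ω => (if ω ∈ twoWorld (endsLoop ends v e₁ e₂) s A X B Y then (if Conn (endsLoop ends v e₁ e₂) ω s u₂ ∧ Conn (endsLoop ends v e₁ e₂) (compl ω) s u₁ then 0 else 1) else (0 : ℕ)))
    (fun ω => gloop_flip ends s A X B Y hd.ne (Or.inl rfl) u₂ u₁ ω)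
    (fun ω => gloop_flip ends s A X B Y hd.ne (Or.inr rfl) u₂ u₁ ω) false true
  have hGS : gensymCount (endsLoop ends v e₁ e₂) s A X B Y u₁ u₂ =
      ∑ ω : Config E, (if ω ∈ twoWorld (endsLoop ends v e₁ e₂) s A X B Y then (if Conn (endsLoop ends v e₁ e₂) ω s u₁ ∧ Conn (endsLoop ends v e₁ e₂) (compl ω) s u₂ then 0 else 1) else (0 : ℕ)) + ∑ ω : Config E, (if ω ∈ twoWorld (endsLoop ends v e₁ e₂) s A X B Y then (if Conn (endsLoop ends v e₁ e₂) ω s u₂ ∧ Conn (endsLoop ends v e₁ e₂) (compl ω) s u₁ then 0 else 1) else (0 : ℕ)) := by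
    unfold gensymCount pairW
    rw [← Finset.sum_add_distrib]
    refine Finset.sum_congr rfl fun ω _ => ?_
    by_cases h : ω ∈ twoWorld (endsLoop ends v e₁ e₂) s A X B Y
    · rw [if_pos h, if_pos h, if_pos h]
    · rw [if_neg h, if_neg h, if_neg h]
  have hRC : reimerCount (endsPlus ends v u₁ u₂ e₁ e₂) s A X B Y = ∑ ω : Config E, (if ω ∈ twoWorld (endsPlus ends v u₁ u₂ e₁ e₂) s A X B Y then (1 : ℕ) else 0) := rfl
  rw [coreCount_singleton_eq_sum, hsplit, hRC, hGS]
  omega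

/-- **(CORE↓) at a vertex of degree 2 follows from Harris on `G⁺` and GENSYM on `G°`**: for a Harris pair
(`X ∩ Y = ∅`) and an unmarked `v ≠ s` of degree 2 with neighbours `u₁, u₂`, GENSYM`(u₁, u₂)` on `G°` gives
(CORE↓) at `{v}`. -/
theorem coreDown_of_genSym (hd : Deg2 ends v u₁ u₂ e₁ e₂) (hsv : s ≠ v) (hv : v ∉ A ∪ X ∪ B ∪ Y)
    (hXY : X ∩ Y = ∅) (hGS : GenSym (endsLoop ends v e₁ e₂) s A X B Y u₁ u₂) :
    CoreDown ends s A X B Y {v} := by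
  unfold CoreDown
  have hv' : v ∉ (A ∪ B) ∪ ∅ ∪ ∅ ∪ (X ∪ Y) := by
    intro h
    apply hv
    simp only [Finset.union_empty, Finset.mem_union] at h
    simp only [Finset.mem_union]
    tauto
  have hL := four_mul_coreCount ends s A X B Y hd hsv hv
  have hR := four_mul_coreCount ends s (A ∪ B) ∅ ∅ (X ∪ Y) hd hsv hv'
  have hHarris := rvdBK_of_disjoint (endsPlus ends v u₁ u₂ e₁ e₂) s A X B Y hXY
  unfold RvdBK at hHarris
  rw [hXY] at hHarris
  unfold GenSym at hGS
  have : 4 * coreCount ends s A X B Y {v} ≤ 4 * coreCount ends s (A ∪ B) ∅ ∅ (X ∪ Y) {v} := by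
    rw [hL, hR]
    exact Nat.add_le_add (Nat.mul_le_mul_left 2 hHarris) hGS
  exact Nat.le_of_mul_le_mul_left this (by norm_num)

end Expansion


end ReimerVdBK
end Summit.Ventures.PercRepro2
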